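import Literature.AnabelianGeometry.EtaleTheta.Discharge.Sec3Thm37OfInputs
import Literature.AnabelianGeometry.EtaleTheta.TemperedFrobenioidLaws
import HarnessLib

/-!
# [EtTh] Theorem 3.7 (i) — NODE CLOSER: the seven printed clauses as ONE theorem in print's shape, in the
# tree's REAL [FrdI] vocabulary and AS TYPED (`TemperedFrobenioid.Thm37_i`) at facade reading slots

S. Mochizuki, *The étale theta function and its Frobenioid-theoretic manifestations*, Publ. RIMS **45**
(2009) [EtTh], §3, Theorem 3.7 (i): statement PDF p. 79 (printed p. 305) ll. 30–31, proof PDF p. 80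
(printed p. 306) ll. 8–15 of `paper:doi-10-2977-prims-1234361159` [cite: MochizukiEtTh2009, Thm 3.7 (i) p.79]:

> "(i) If `Λ = ℤ` (respectively, `Λ = ℝ`), then `C` is of unit-profinite (respectively, unit-trivial) type.
> For arbitrary `Λ`, the Frobenioid `C` is of isotropic, model [hence, in particular, birationally
> Frobenius-normalized], and sub-quasi-Frobenius-trivial type, but not of group-like type."

Proof-only companion (theorems only: no `def`, no `Prop` fact, no instance; abc-iut cell, layer L2, cone node
**`EtTh:Thm3.7(i)`**; R-C «per-node clause coverage», seat abc-iut-w4-d103).  Nothing landed is edited or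
restated: every clause-level closer exists (sub-DAG `plan/L2/SUBDAG-EtTh-Thm37.md` rows L01–L07:
`thm37_i_treeClauses5_treeCatVocab` — isotropic / model / birationally Frobenius-normalized / sub-quasi-Frobenius-
trivial / not group-like, `Sec3Thm37ModelType` p414283 over `Sec3Thm37Standard` p413076, `Sec3Thm37` (abc-iut-L6-t13),
`Sec3Thm37SubQFT` (abc-iut-L1-t1); `isOfUnitProfiniteType_of_kerIsoPadicUnits` — unit-profinite for `Λ = ℤ` from
Prop. 3.4 (ii) iso 1 BY NAME, `Sec3Thm37UnitProfinite` p414441; `thm37_i_unitTrivial_of_divΛ_injective` — unit-trivial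
for `Λ = ℝ`, `Sec3Thm37Units` p414061, both abc-iut-w5-d164), and the END KNIT `thm37_of_inputs` (p429227) carries
them as its conjunct (i) — but together with the (ii)/(iii) binders `hD hnd hrat hKfix P`.  THIS FILE isolates the
node: `hZ → unit-profinite`, `hR → unit-trivial` and the five `Λ`-free clauses as ONE conjunction whose ONLY
binders are the node's own:

* §1 `thm37_i_node (hBmon) (hP34) (hinj)` — real vocabulary at `treeCatVocab`, any monoid type; residual =
  {`hBmon` ([FrdI] Thm 5.2 preamble «`𝔹` a monoid on `D`»), `hP34` (ONLY if `Λ = ℤ`: Prop. 3.4 (ii) first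
  isomorphism `Ker(B₀^Λ(Y)ˣ → (Φ₀^ℝ)^gp(Y)) ≅ O_L^×` in tree currency — print: "By Proposition 3.4, (ii) … if
  `Λ = ℤ` … unit-profinite"), `hinj` (ONLY if `Λ = ℝ`: `B₀^ℝ → (Φ₀^ℝ)^gp` injective — print: "by the definition of
  the realification"; a THEOREM at the constructed data `ofRlfR`, `RealifiedDivisorMonoids.ofRlfR_divΛ_injective`)};
  `thm37_i_node_of_laws` — `hBmon` ⟸ the structure owner's NAMED LAW `TemperedFrobenioid.BaseInj` (abc-iut-L2-t3,
  census A9) + «FSM-morphisms of `D` are isomorphisms» (`isMonoidOn_ratFnFunctor_of_baseInj'`).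
* §2 AS TYPED.  abc-iut-L2-t3's typed node statement `TemperedFrobenioid.Thm37_i C₀ F` reads three of the seven
  clauses ("unit-profinite", "model", "birationally Frobenius-normalized" type — [FrdI] Def. 2.8 (ii), 4.5 (i))
  through FREE fields of the hypothesis vocabulary `F : FrobenioidFacade D` (its universal closure is refuted in
  the tree: `exists_facade_not_thm37_i`, `TemperedFrobenioidPropsSchemaNegative`); the other four are the tree's
  [FrdI] Def. 1.2 predicates.  `thm37_i_of_slots` inhabits `C₀.Thm37_i F` at every facade whose three fields are
  implied AT `C₀` by L1's real predicates (`PreFrobenioid.IsOfUnitProfiniteType`, `PreFrobenioid.IsOfModelType`,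
  `PreFrobenioidData.IsOfBiratFrobeniusNormalizedType` at THE birationalization) — reading slots `hUP`, `hMT`,
  `hBFN` — from {`hBmon`, `hP34`, `hinj`}; `thm37_i_of_slots_of_laws` with `hBmon` ⟸ {`BaseInj`, FSM ⇒ iso}.

HONEST FRAMING: refereed pre-IUT material ([EtTh] §3 over [FrdI] §§1–5, [FrdII] Thm 1.2 (i)); bookkeeping over
PROVED rows, no new mathematics; the residual binders are properties of the abstract Def. 3.3 (iii) / 3.6 (i)–(ii)
data not recorded by the typed interface, dischargeable only at instantiated data (`ofRlfZ`/`ofRlfR` knits of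
`Sec3Thm37OfInputs*`, `Sec3Thm37OfRankOnePointR`); nothing here bears on [IUTchIII] Cor. 3.12; no statement of
either paper is strengthened; typed ≠ proved — here PROVED modulo the literal binders.
-/

namespace Literature.AnabelianGeometry.EtaleTheta

open CategoryTheory Opposite Literature.AlgebraicGeometry.Frobenioids

namespace TemperedFrobenioid

universe u₀ v₀ u v w uK

variable {D₀ : Type u₀} [Category.{v₀} D₀] {V : FrdIMonoidStub.{w}}
  {T : RealifiedDivisorMonoids (D₀ := D₀) V} {D : Type u} [Category.{v} D]
  {IsRational IsStrictlyRational : (Dᵒᵖ ⥤ CommMonCat.{w}) → Prop}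
  (C₀ : TemperedFrobenioid T D (treeCatVocab D IsRational IsStrictlyRational)) {p : ℕ} [Fact p.Prime]

/-! ### §1 The node in print's shape, real [FrdI] vocabulary, canonical category vocabulary `treeCatVocab` -/

/-- **[EtTh] Thm 3.7 (i) — the node in print's shape** (any monoid type `Λ`), for the tempered Frobenioid `C` (the
model Frobenioid of the Def. 3.6 (ii) data) over the canonical vocabulary, GIVEN `hBmon` ([FrdI] Thm 5.2 preamble),
`hP34` (used only if `Λ = ℤ`) and `hinj` (used only if `Λ = ℝ`): (1) `Λ = ℤ` ⇒ `C` of unit-profinite type ([FrdI]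
Def. 2.8 (ii), L1's `PreFrobenioid.IsOfUnitProfiniteType`; print: "By Proposition 3.4, (ii)"), (2) `Λ = ℝ` ⇒ `C` of
unit-trivial type ([FrdI] Def. 1.2 (iv); print: "by the definition of the realification"), (3) isotropic, (4) model
([FrdI] Def. 4.5 (i) at THE birationalization; print: "[Mzk17], Theorem 5.2, (ii)"), (5) birationally
Frobenius-normalized, (6) sub-quasi-Frobenius-trivial ("[Mzk17], Proposition 1.10, (vi)"), (7) not group-like
("the condition imposed on `F` in Definition 3.6, (ii), (b)").  Composition of `isOfUnitProfiniteType_of_kerIsoPadicUnits`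
(p414441), `thm37_i_unitTrivial_of_divΛ_injective` (p414061), `thm37_i_treeClauses5_treeCatVocab` (p414283) — the
conjunct (i) of the END KNIT `thm37_of_inputs` (p429227) WITHOUT its (ii)/(iii) binders.
[cite: MochizukiEtTh2009, Thm 3.7 (i) p.79] -/
theorem thm37_i_node (hBmon : IsMonoidOn C₀.ratFnFunctor)
    (hP34 : C₀.monoidType = MonoidType.Z → ∀ A : Dᵒᵖ, ∃ L : PadicFrd.PadicFld.{uK} p, L.IsPadicLocal ∧
      Nonempty (((T.divΛ (C₀.baseOp A)).comp (Units.coeHom (T.BΛ.obj (C₀.baseOp A)))).ker ≃*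
        PadicFrd.unitSubgroup L.K))
    (hinj : C₀.monoidType = MonoidType.R → ∀ A : Dᵒᵖ, Function.Injective (T.divΛ (C₀.baseOp A))) :
    (C₀.monoidType = MonoidType.Z → PreFrobenioid.IsOfUnitProfiniteType C₀.toElem) ∧
      (C₀.monoidType = MonoidType.R → PreFrobenioid.IsOfType (PreFrobenioid.IsUnitTrivial C₀.toElem)) ∧
      PreFrobenioid.IsOfIsotropicType C₀.toElem ∧
      PreFrobenioid.IsOfModelType C₀.toElem (C₀.isFrobenioid_treeCatVocab_of_isMonoidOn hBmon)
        (PreFrobenioid.hasBiratSquares_of_isFrobenioid (C₀.isFrobenioid_treeCatVocab_of_isMonoidOn hBmon)) ∧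
      PreFrobenioidData.IsOfBiratFrobeniusNormalizedType
        (PreFrobenioid.biratData (C₀.isFrobenioid_treeCatVocab_of_isMonoidOn hBmon)
          (PreFrobenioid.hasBiratSquares_of_isFrobenioid (C₀.isFrobenioid_treeCatVocab_of_isMonoidOn hBmon))) ∧
      PreFrobenioid.IsOfType (PreFrobenioid.IsSubQuasiFrobeniusTrivial C₀.toElem) ∧
      ¬ PreFrobenioid.IsOfType (PreFrobenioid.IsGroupLikeObj C₀.toElem) :=
  have hF := C₀.isFrobenioid_treeCatVocab_of_isMonoidOn hBmon
  ⟨fun hZ => C₀.isOfUnitProfiniteType_of_kerIsoPadicUnits hF (hP34 hZ),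
    fun hR => C₀.thm37_i_unitTrivial_of_divΛ_injective hF (hinj hR),
    C₀.thm37_i_treeClauses5_treeCatVocab hBmon⟩

/-- **The node with `hBmon` supplied by the structure owner's NAMED LAW** `TemperedFrobenioid.BaseInj` (census A9,
abc-iut-L2-t3) and «FSM-morphisms of `D` are isomorphisms» ([FrdI] Def. 1.1 (ii)(b); a theorem at the genuine base
`B^temp(Π)⁰`), via `isMonoidOn_ratFnFunctor_of_baseInj'`. [cite: MochizukiEtTh2009, Thm 3.7 (i) p.79] -/
theorem thm37_i_node_of_laws (hB : C₀.BaseInj) (hFSM : ∀ {A B : D} (α : B ⟶ A), IsFSM α → IsIso α)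
    (hP34 : C₀.monoidType = MonoidType.Z → ∀ A : Dᵒᵖ, ∃ L : PadicFrd.PadicFld.{uK} p, L.IsPadicLocal ∧
      Nonempty (((T.divΛ (C₀.baseOp A)).comp (Units.coeHom (T.BΛ.obj (C₀.baseOp A)))).ker ≃*
        PadicFrd.unitSubgroup L.K))
    (hinj : C₀.monoidType = MonoidType.R → ∀ A : Dᵒᵖ, Function.Injective (T.divΛ (C₀.baseOp A))) :
    (C₀.monoidType = MonoidType.Z → PreFrobenioid.IsOfUnitProfiniteType C₀.toElem) ∧
      (C₀.monoidType = MonoidType.R → PreFrobenioid.IsOfType (PreFrobenioid.IsUnitTrivial C₀.toElem)) ∧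
      PreFrobenioid.IsOfIsotropicType C₀.toElem ∧
      PreFrobenioid.IsOfModelType C₀.toElem
        (C₀.isFrobenioid_treeCatVocab_of_isMonoidOn (C₀.isMonoidOn_ratFnFunctor_of_baseInj' hB hFSM))
        (PreFrobenioid.hasBiratSquares_of_isFrobenioid
          (C₀.isFrobenioid_treeCatVocab_of_isMonoidOn (C₀.isMonoidOn_ratFnFunctor_of_baseInj' hB hFSM))) ∧
      PreFrobenioidData.IsOfBiratFrobeniusNormalizedType
        (PreFrobenioid.biratData
          (C₀.isFrobenioid_treeCatVocab_of_isMonoidOn (C₀.isMonoidOn_ratFnFunctor_of_baseInj' hB hFSM))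
          (PreFrobenioid.hasBiratSquares_of_isFrobenioid
            (C₀.isFrobenioid_treeCatVocab_of_isMonoidOn (C₀.isMonoidOn_ratFnFunctor_of_baseInj' hB hFSM)))) ∧
      PreFrobenioid.IsOfType (PreFrobenioid.IsSubQuasiFrobeniusTrivial C₀.toElem) ∧
      ¬ PreFrobenioid.IsOfType (PreFrobenioid.IsGroupLikeObj C₀.toElem) :=
  C₀.thm37_i_node (C₀.isMonoidOn_ratFnFunctor_of_baseInj' hB hFSM) hP34 hinj

/-! ### §2 AS TYPED: `TemperedFrobenioid.Thm37_i C₀ F` at facade reading slots -/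

/-- **[EtTh] Thm 3.7 (i) AS TYPED** (abc-iut-L2-t3's `Thm37_i`, p407532) **at facade reading slots**: for every
hypothesis vocabulary `F : FrobenioidFacade D` whose fields "of unit-profinite type", "of model type", "of
birationally Frobenius-normalized type" are implied AT `C₀` by L1's real [FrdI] predicates (Def. 2.8 (ii)
`PreFrobenioid.IsOfUnitProfiniteType`; Def. 4.5 (i) `PreFrobenioid.IsOfModelType` /
`PreFrobenioidData.IsOfBiratFrobeniusNormalizedType` at THE birationalization `PreFrobenioid.biratData`) — reading
slots `hUP`, `hMT`, `hBFN` — the typed statement `C₀.Thm37_i F` HOLDS, given {`hBmon`, `hP34` (`Λ = ℤ` only),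
`hinj` (`Λ = ℝ` only)}.  The free-slot schema itself is refuted as a universal closure (`exists_facade_not_thm37_i`);
this is its inhabitant at every honest slot. [cite: MochizukiEtTh2009, Thm 3.7 (i) p.79] -/
theorem thm37_i_of_slots (F : FrobenioidFacade.{u, v, w} D) (hBmon : IsMonoidOn C₀.ratFnFunctor)
    (hP34 : C₀.monoidType = MonoidType.Z → ∀ A : Dᵒᵖ, ∃ L : PadicFrd.PadicFld.{uK} p, L.IsPadicLocal ∧
      Nonempty (((T.divΛ (C₀.baseOp A)).comp (Units.coeHom (T.BΛ.obj (C₀.baseOp A)))).ker ≃*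
        PadicFrd.unitSubgroup L.K))
    (hinj : C₀.monoidType = MonoidType.R → ∀ A : Dᵒᵖ, Function.Injective (T.divΛ (C₀.baseOp A)))
    (hUP : PreFrobenioid.IsOfUnitProfiniteType C₀.toElem → F.IsOfUnitProfiniteType C₀.toElem)
    (hMT : PreFrobenioid.IsOfModelType C₀.toElem (C₀.isFrobenioid_treeCatVocab_of_isMonoidOn hBmon)
        (PreFrobenioid.hasBiratSquares_of_isFrobenioid (C₀.isFrobenioid_treeCatVocab_of_isMonoidOn hBmon)) →
      F.IsOfModelType C₀.toElem)
    (hBFN : PreFrobenioidData.IsOfBiratFrobeniusNormalizedType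
        (PreFrobenioid.biratData (C₀.isFrobenioid_treeCatVocab_of_isMonoidOn hBmon)
          (PreFrobenioid.hasBiratSquares_of_isFrobenioid (C₀.isFrobenioid_treeCatVocab_of_isMonoidOn hBmon))) →
      F.IsOfBiratFrobeniusNormalizedType C₀.toElem) :
    C₀.Thm37_i F :=
  have h := C₀.thm37_i_node (p := p) hBmon hP34 hinj
  ⟨fun hZ => hUP (h.1 hZ), h.2.1, h.2.2.1, hMT h.2.2.2.1, hBFN h.2.2.2.2.1, h.2.2.2.2.2.1, h.2.2.2.2.2.2⟩

/-- **AS TYPED at the reading slots from NAMED LAWS of the data** — `hBmon` ⟸ `TemperedFrobenioid.BaseInj` + the FSM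
clause: the typed node `C₀.Thm37_i F` holds at every honest facade for every tempered Frobenioid over the canonical
category vocabulary whose Def. 3.3 (iii) / 3.6 (i)–(ii) data satisfy {`BaseInj`, FSM ⇒ iso, `hP34` if `Λ = ℤ`,
`hinj` if `Λ = ℝ`} — no other input. [cite: MochizukiEtTh2009, Thm 3.7 (i) p.79] -/
theorem thm37_i_of_slots_of_laws (F : FrobenioidFacade.{u, v, w} D) (hB : C₀.BaseInj)
    (hFSM : ∀ {A B : D} (α : B ⟶ A), IsFSM α → IsIso α)
    (hP34 : C₀.monoidType = MonoidType.Z → ∀ A : Dᵒᵖ, ∃ L : PadicFrd.PadicFld.{uK} p, L.IsPadicLocal ∧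
      Nonempty (((T.divΛ (C₀.baseOp A)).comp (Units.coeHom (T.BΛ.obj (C₀.baseOp A)))).ker ≃*
        PadicFrd.unitSubgroup L.K))
    (hinj : C₀.monoidType = MonoidType.R → ∀ A : Dᵒᵖ, Function.Injective (T.divΛ (C₀.baseOp A)))
    (hUP : PreFrobenioid.IsOfUnitProfiniteType C₀.toElem → F.IsOfUnitProfiniteType C₀.toElem)
    (hMT : PreFrobenioid.IsOfModelType C₀.toElem
        (C₀.isFrobenioid_treeCatVocab_of_isMonoidOn (C₀.isMonoidOn_ratFnFunctor_of_baseInj' hB hFSM))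
        (PreFrobenioid.hasBiratSquares_of_isFrobenioid
          (C₀.isFrobenioid_treeCatVocab_of_isMonoidOn (C₀.isMonoidOn_ratFnFunctor_of_baseInj' hB hFSM))) →
      F.IsOfModelType C₀.toElem)
    (hBFN : PreFrobenioidData.IsOfBiratFrobeniusNormalizedType
        (PreFrobenioid.biratData
          (C₀.isFrobenioid_treeCatVocab_of_isMonoidOn (C₀.isMonoidOn_ratFnFunctor_of_baseInj' hB hFSM))
          (PreFrobenioid.hasBiratSquares_of_isFrobenioid
            (C₀.isFrobenioid_treeCatVocab_of_isMonoidOn (C₀.isMonoidOn_ratFnFunctor_of_baseInj' hB hFSM)))) →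
      F.IsOfBiratFrobeniusNormalizedType C₀.toElem) :
    C₀.Thm37_i F :=
  C₀.thm37_i_of_slots (p := p) F (C₀.isMonoidOn_ratFnFunctor_of_baseInj' hB hFSM) hP34 hinj hUP hMT hBFN

end TemperedFrobenioid

end Literature.AnabelianGeometry.EtaleTheta
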